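import Literature.MathematicalPhysics.QuantumFieldTheory.Balaban1983to89.B9Eq353FormDefectTowerTwoBackgrounds
import Literature.MathematicalPhysics.QuantumFieldTheory.Balaban1983to89.B9Eq3126H1LipschitzEnergy

/-!
# `Balaban1983to89.B9Eq3126H1kLipschitzEnergyTwoBackgrounds` — T. Bałaban, *Propagators for lattice gauge theories in a background field*, Commun. Math. Phys.
# **99** (1985) 389–434 [Balaban1985BackgroundPropagators] (3.126) p. 420 with Thm 3.4 p. 400, (3.84)–(3.86) p. 407 AT `k = n+1` AVERAGING LEVELS ON PRINT's
# DIAGONAL, BETWEEN TWO SMALL BACKGROUNDS: **`‖H_{1,k}(U)b − H_{1,k}(V)b‖_{N₁} ≤ C·δ·‖b‖` MODULO `C_R^{(2)}`, `C_{K,V}`, `C_{K,U}`** — the two-background («(b3)»)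
# twin of the NE9 owner's storey 5 `B9Eq3126H1kLipschitzEnergyDiagonal` (there `V = 1`, `δ = α`): leaf-02's abstract minimiser defect identity
# `B9Eq3126H1LipschitzEnergy.norm_apply_H1K_sub_le` (structures 0 := `V`, 1 := `U`) fed with INTENT-7's two-background form defect, the strong coercivities
# at `U` and `V` in the FLAT weight, and the two-background averaging letter `δ_Q(U,V)` of `B9Eq315QTowerLipschitzL2TwoBackgroundsChain`

statement-level skeleton of published theorems with citation tags; proofs where landed; nothing here is a claim about the Yang–Mills mass gap

PDF held: `paper:balaban1985-cmp99-background-propagators` (journal page = PDF page + 388), pp. 400, 407, 420 through the suppliers' quotations.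

CITATION HEADER (lean-in-tree rule 2026-08-18).  Audit cell `pub-balaban`, sub-cell `t4`, NE9 crux team (2): LEAF PROVER 04 (`b2b-balaban-t4-ne9-formalise-leaf-04`
gen 77), INTENT-10.  WHY: the (b3) ladder's `H_{1,k}` storey — the minimiser `H_k` of two histories compared at one level, the input of the two-background
`𝔊_k` and (117) storeys (the OWNER's offer l.51017).

THE PRINT.  (3.126) p. 420: `H_k = G_k Q_k^* (Q_k G_k Q_k^*)^{-1}`; (3.86) p. 407: the letters are Lipschitz in the background; [B11] (45)–(46) p. 285.

WHAT IS PROVED (sorry-free; 0 `def`; [folklore] composition BY NAME; nothing of [B9] asserted as printed).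
* **`exists_norm_H1k_sub_H1k_le_two_backgrounds_closed`** — `∃ α₀ δ₀ C > 0` (`C` closed in `(d, a, L, M_φ, M_φ′, r, C_τ, ρ_w, C_R^{(2)}, C_{K,V}, C_{K,U})`) BEFORE
  the binders of `B9Eq353FormDefectTowerTwoBackgrounds.exists_form_defect_two_backgrounds_diagonal_closed` + the plaquette window of `V`, then for ANY positivity
  witnesses `hposU`, `hposV`, ANY onto-witnesses `hQU`, `hQV`, the two `K⁻¹`-letters `‖K_k(V)⁻¹b‖ ≤ C_{K,V}‖b‖`, `‖K_k(U)⁻¹c‖ ≤ C_{K,U}‖c‖` and every block field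
  `b`: `‖H_k(U)b − H_k(V)b‖, ‖curl₁(…)‖, ‖div₁(…)‖ ≤ C·δ·‖b‖`, `H_k(X) = H1LatticeK hposX hQX`.
MODEL ∕ DECLARED READINGS.  Those of INTENT-7 and of the owner's storey 5 (`K⁻¹`-letters and witnesses as binders).
HONEST SCOPE.  FIRST order between two small backgrounds on the diagonal ONLY; the `L²`∕energy clause — no kernel bound, no decay, NOT [B9] Thm 3.12; crude
constants.  NOT summit progress (cell pub-balaban: NE9 NOT PRINTED ∕ NOT PROVED; «NE9 ⇐ the named binders»; row WALLED ON A MODEL (O-NE9-1; #5 UNRULED); spine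
PROVED 0∕9; rung (B)+1 finite T⁴ — NOT infinite volume, NOT mass gap, NOT BetaPertH, NOT Clay).  HONEST DEPENDENCY (cell line): continuum YM on T⁴ ⇐ BetaPertH ∧
nine spine estimates (0/9 proved); BetaPertH ⇐ (D1) ∧ (D4) ∧ CAP+tail; G-an2-4 gates asym, D1 and NE2/3/4.  NEW file; nothing modified.  Net new unproved facts: 0.
-/

noncomputable section

open scoped InnerProductSpace ComplexConjugate BigOperators

namespace Literature.MathematicalPhysics.QuantumFieldTheory.Balaban1983to89.B9Eq3126H1kLipschitzEnergyTwoBackgrounds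

open B4Sect5Torus (TSite)
open B9SectCLatticeCarrier (Bond)
open B11Eq103H1Complex (SiteL2K BondL2K covDerivL2K covDivL2K H1LatticeK KinvLatticeK H1K KinvK adjoint_injective_of_surjective)
open B9Eq310HessianOperator (adTransportW hessOp covCurlL2K)
open B9Eq310DeltaPrime (plaqHolU)
open B9Eq315QTorus (perCfg cornerSite)
open B9Eq315QTower (towerP UlevOf)
open B9Eq326OperatorTower (laplaceAk QkW RofUk)
open B7Prop1Explicit (U1 Wcx boxVec)
open B9Eq315QTowerLipschitzL2TwoBackgroundsChain (norm_QkW_sub_QkW_le_L2_linear)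
open B9Eq3153FrakGkBoundDiagonal (exists_energy_letters_diagonal_closed)
open B9Eq353FormDefectTowerTwoBackgrounds (exists_form_defect_two_backgrounds_diagonal_closed)
open B9Eq3126H1LipschitzEnergy (norm_apply_H1K_sub_le)

/-! ## §1 Arithmetic -/

/-- On the diagonal `c₀(L^{n+1})^d = c₁` the weighted-reading prefactor is `1`. [cite: Balaban1985BackgroundPropagators, (3.16) p.393] -/
private theorem sqrt_ratio_diagonal {d L n : ℕ} {c₀ c₁ : ℝ} (hc₁ : 0 < c₁) (hw : c₀ * ((L : ℝ) ^ (n + 1)) ^ d = c₁) :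
    Real.sqrt (c₁ / (c₀ * ((L : ℝ) ^ (n + 1)) ^ d)) = 1 := by
  rw [hw, div_self hc₁.ne', Real.sqrt_one]

/-- `x ≤ √S` from `0 ≤ x` and `x² ≤ S`. [folklore] -/
private theorem le_sqrt_of_sq_le {x S : ℝ} (hx : 0 ≤ x) (h : x ^ 2 ≤ S) : x ≤ Real.sqrt S := by
  rw [← Real.sqrt_sq hx]; exact Real.sqrt_le_sqrt h

/-! ## §2 `H_{1,k}(U) − H_{1,k}(V)` in the flat energy norm on the diagonal -/

variable {d : ℕ} (L : ℕ) [NeZero L] (hL : 1 ≤ L)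
  {𝔸 : Type*} [NormedRing 𝔸] [NormedAlgebra ℂ 𝔸] [CompleteSpace 𝔸] [NormOneClass 𝔸] [StarRing 𝔸] [NormedStarGroup 𝔸] [StarModule ℂ 𝔸]
  {W : Type*} [NormedAddCommGroup W] [InnerProductSpace ℂ W] [FiniteDimensional ℂ W] (φ : W ≃ₗ[ℂ] 𝔸)
  {Mφ Mφ' : ℝ} (hMφ : 0 ≤ Mφ) (hMφ' : 0 ≤ Mφ') (hφ : ∀ w, ‖φ w‖ ≤ Mφ * ‖w‖) (hφ' : ∀ X, ‖φ.symm X‖ ≤ Mφ' * ‖X‖)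
  {a : ℝ} (ha : 0 < a) {r : ℝ} (hr0 : 0 ≤ r) (hr1 : r < 1)
  (τ : 𝔸 →ₗ[ℂ] ℂ) {Cτ : ℝ} (hτ : ∀ X, ‖τ X‖ ≤ Cτ * ‖X‖) (hCτ : 0 ≤ Cτ) {ρw : ℝ} (hρw : 0 ≤ ρw) {CR : ℝ} (hCR : 0 ≤ CR)
  {CKV CKU : ℝ} (hCKV : 0 ≤ CKV) (hCKU : 0 ≤ CKU)

include hMφ hMφ' hφ hφ' ha hr0 hr1 hτ hCτ hρw hCR hCKV hCKU

-- deep definitional unfolding `H1LatticeK`∕`KinvLatticeK` ↦ `H1K`∕`KinvK` (as in the owner's storey 5)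
set_option maxRecDepth 8192 in
/-- **`H_{1,k}(U) − H_{1,k}(V) = O(δ)` IN THE FLAT ENERGY NORM ON THE DIAGONAL, MODULO `C_R^{(2)}`, `C_{K,V}`, `C_{K,U}`**: `∃ α₀ δ₀ C > 0` (closed) such that
under the binders of `exists_form_defect_two_backgrounds_diagonal_closed` plus the plaquette window of `V`, for ANY positivity witnesses `hposU`, `hposV`, ANY
onto-witnesses `hQU`, `hQV`, the two `K⁻¹`-letters and every block field `b`: `‖H_k(U)b − H_k(V)b‖, ‖curl₁(…)‖, ‖div₁(…)‖ ≤ C·δ·‖b‖` — the minimiser's exact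
defect identity (`norm_apply_H1K_sub_le`, structures 0 := `V`, 1 := `U`) at the coercivities `γ₁` (flat weight) of `Δ_a(U)`, `Δ_a(V)`, the two-background form
defect `Θ̄₂δ` and the averaging defect `s_Qδ`.  No operator bound of `Δ_a`, no `H`-letter, no Neumann series.
[cite: Balaban1985BackgroundPropagators, (3.126) p.420, Thm 3.4 p.400, (3.84)–(3.86) p.407, (3.35) p.396; Balaban1985Variational, (45)–(46) p.285] -/
theorem exists_norm_H1k_sub_H1k_le_two_backgrounds_closed :
    ∃ α₀ δ₀ C : ℝ, 0 < α₀ ∧ 0 < δ₀ ∧ 0 < C ∧ ∀ (n : ℕ) (η : ℝ), η * (L : ℝ) ^ (n + 1) = 1 →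
      ∀ (c₀ c₁ : ℝ) [Fact (0 < c₀)] [Fact (0 < c₁)], c₀ * ((L : ℝ) ^ (n + 1)) ^ d = c₁ → |η| ^ d / c₀ ≤ ρw →
      ∀ (m : Fin d → ℕ) [∀ i, NeZero (m i)] (U V : Bond d (towerP L m (n + 1)) → 𝔸ˣ) (αU : ℕ → ℝ) (hα1 : ∀ j, αU j ≤ 1 / 64)
        (hU1 : ∀ (j : ℕ) (x : B7Prop1Explicit.Site d) (κ : Fin d), perCfg (towerP L m (j + 1)) (UlevOf L m (n + 1) U j) x κ ∈ U1 𝔸)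
        (hreg : ∀ (j : ℕ) (y : TSite d (towerP L m j)) (κ : Fin d) (r : Fin d → Fin L),
          ‖((Wcx L (perCfg (towerP L m (j + 1)) (UlevOf L m (n + 1) U j)) (cornerSite L y) κ (boxVec L r) : 𝔸ˣ) : 𝔸) - 1‖ ≤ αU j)
        (αV : ℕ → ℝ) (hα1' : ∀ j, αV j ≤ 1 / 64)
        (hV1 : ∀ (j : ℕ) (x : B7Prop1Explicit.Site d) (κ : Fin d), perCfg (towerP L m (j + 1)) (UlevOf L m (n + 1) V j) x κ ∈ U1 𝔸)
        (hregV : ∀ (j : ℕ) (y : TSite d (towerP L m j)) (κ : Fin d) (r : Fin d → Fin L),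
          ‖((Wcx L (perCfg (towerP L m (j + 1)) (UlevOf L m (n + 1) V j)) (cornerSite L y) κ (boxVec L r) : 𝔸ˣ) : 𝔸) - 1‖ ≤ αV j),
        (∀ j, αV j ≤ 1 / 128) →
      ∀ (εU : ℕ → ℝ), (∀ j, 0 ≤ εU j) → (∀ (j : ℕ) (b : Bond d (towerP L m (j + 1))), ‖(UlevOf L m (n + 1) U j b : 𝔸) - 1‖ ≤ εU j) →
        (∀ (j : ℕ) (b : Bond d (towerP L m (j + 1))), ‖(UlevOf L m (n + 1) V j b : 𝔸) - 1‖ ≤ εU j) →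
      ∀ (δUV : ℕ → ℝ), (∀ j, 0 ≤ δUV j) →
        (∀ (j : ℕ) (b : Bond d (towerP L m (j + 1))), ‖(UlevOf L m (n + 1) U j b : 𝔸) - (UlevOf L m (n + 1) V j b : 𝔸)‖ ≤ δUV j) →
      ∀ {α δ : ℝ}, 0 ≤ α → α ≤ α₀ → 0 ≤ δ → δ ≤ δ₀ →
        (∀ (b : Bond d (towerP L m (n + 1))) (v u : W), ⟪adTransportW φ U b v, u⟫_ℂ = ⟪v, adTransportW φ (fun b => (U b)⁻¹) b u⟫_ℂ) →
        (∀ (b : Bond d (towerP L m (n + 1))) (v u : W), ⟪adTransportW φ V b v, u⟫_ℂ = ⟪v, adTransportW φ (fun b => (V b)⁻¹) b u⟫_ℂ) →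
        (∀ b, U b ∈ U1 𝔸) → (∀ b, V b ∈ U1 𝔸) → (∀ b, ‖(U b : 𝔸) - 1‖ ≤ α * η) → (∀ b, ‖(V b : 𝔸) - 1‖ ≤ α * η) →
        (∀ p : B9SectCLatticeCarrier.Plaq d (towerP L m (n + 1)), ‖(plaqHolU U p : 𝔸) - 1‖ ≤ α * η ^ 2) →
        (∀ p : B9SectCLatticeCarrier.Plaq d (towerP L m (n + 1)), ‖(plaqHolU V p : 𝔸) - 1‖ ≤ α * η ^ 2) →
        (∀ b, ‖(U b : 𝔸) - (V b : 𝔸)‖ ≤ δ * η) →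
        (∀ p : B9SectCLatticeCarrier.Plaq d (towerP L m (n + 1)), ‖(plaqHolU U p : 𝔸) - (plaqHolU V p : 𝔸)‖ ≤ δ * η ^ 2) →
        (∀ j < n + 1, εU j ≤ α * r ^ j) → (∀ j, δUV j ≤ δ * r ^ j) →
        (∀ s : SiteL2K ℂ d (towerP L m (n + 1)) c₀ W, ‖RofUk L m n φ η U s - RofUk L m n φ η V s‖ ≤ CR * δ * ‖s‖) →
        ∀ (hposU : ∀ x : BondL2K ℂ d (towerP L m (n + 1)) c₀ W, x ≠ 0 →
            0 < RCLike.re ⟪x, laplaceAk L m n φ η U hL αU hα1 hU1 hreg τ (c₀ := c₀) (c₁ := c₁) a x⟫_ℂ)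
          (hposV : ∀ x : BondL2K ℂ d (towerP L m (n + 1)) c₀ W, x ≠ 0 →
            0 < RCLike.re ⟪x, laplaceAk L m n φ η V hL αV hα1' hV1 hregV τ (c₀ := c₀) (c₁ := c₁) a x⟫_ℂ)
          (hQU : Function.Surjective (QkW L m n φ U hL αU hα1 hU1 hreg (c₀ := c₀) (c₁ := c₁)))
          (hQV : Function.Surjective (QkW L m n φ V hL αV hα1' hV1 hregV (c₀ := c₀) (c₁ := c₁))),
        (∀ b : BondL2K ℂ d m c₁ W, ‖KinvLatticeK hposV hQV b‖ ≤ CKV * ‖b‖) →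
        (∀ c : BondL2K ℂ d m c₁ W, ‖KinvLatticeK hposU hQU c‖ ≤ CKU * ‖c‖) →
        ∀ b : BondL2K ℂ d m c₁ W,
          ‖H1LatticeK hposU hQU b - H1LatticeK hposV hQV b‖ ≤ C * δ * ‖b‖ ∧
          ‖covCurlL2K ℂ c₀ ((η : ℂ))⁻¹ (adTransportW φ (fun _ : Bond d (towerP L m (n + 1)) => (1 : 𝔸ˣ))) (H1LatticeK hposU hQU b - H1LatticeK hposV hQV b)‖ ≤
            C * δ * ‖b‖ ∧
          ‖covDivL2K ℂ c₀ ((η : ℂ))⁻¹ (adTransportW φ fun _ : Bond d (towerP L m (n + 1)) => (1 : 𝔸ˣ)⁻¹) (H1LatticeK hposU hQU b - H1LatticeK hposV hQV b)‖ ≤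
            C * δ * ‖b‖ := by
  obtain ⟨α₁, γ₁, hα₁, hγ₁, H1⟩ := exists_energy_letters_diagonal_closed L hL φ hMφ hMφ' hφ hφ' ha hr0 hr1 τ hτ hCτ hρw
  obtain ⟨α₂, δ₂, Θ, hα₂, hδ₂, hΘ, H2⟩ :=
    exists_form_defect_two_backgrounds_diagonal_closed L hL φ hMφ hMφ' hφ hφ' ha hr0 hr1 τ hτ hCτ hρw hCR
  have hL1 : (1 : ℝ) ≤ L := by exact_mod_cast hL
  have h1r : 0 < 1 - r := by linarith
  obtain ⟨Ξ, hΞdef⟩ : ∃ Ξ : ℝ, Ξ = Real.sqrt ((L : ℝ) ^ d) * (Real.sqrt (2 * d) * (102 * (d + 1) ^ 2 * L)) := ⟨_, rfl⟩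
  obtain ⟨BQ, hBQdef⟩ : ∃ BQ : ℝ, BQ = Real.sqrt ((L : ℝ) ^ d) * (Real.sqrt (2 * d) * (75497472 * ((d : ℝ) + 1) * ((2 * (d * L) + L + L : ℕ) : ℝ))) / (1 - r) := ⟨_, rfl⟩
  obtain ⟨sQ, hsQdef⟩ : ∃ sQ : ℝ, sQ = Mφ' * Mφ * (2 * Real.exp 1 * BQ) := ⟨_, rfl⟩
  have hΞ0 : 0 ≤ Ξ := by rw [hΞdef]; positivity
  have hBQ : 0 ≤ BQ := by rw [hBQdef]; positivity
  have hsQ : 0 ≤ sQ := by rw [hsQdef]; positivity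
  have hMM : 0 ≤ Mφ' * Mφ := mul_nonneg hMφ' hMφ
  have hNN : (0 : ℝ) < 12288 * ((2 * (d * L) + L + L : ℕ) : ℝ) := by
    have : (1 : ℝ) ≤ ((2 * (d * L) + L + L : ℕ) : ℝ) := by exact_mod_cast (show 1 ≤ 2 * (d * L) + L + L by nlinarith [hL])
    positivity
  obtain ⟨Cb, hCbdef⟩ : ∃ Cb : ℝ, Cb = (Θ * Real.sqrt (CKV / γ₁) + sQ * CKV) / γ₁ + Real.sqrt (CKU / γ₁) * (sQ * Real.sqrt (CKV / γ₁)) := ⟨_, rfl⟩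
  have hCb : 0 ≤ Cb := by rw [hCbdef]; positivity
  refine ⟨min (min α₁ α₂) ((1 - r) / (Ξ + 1)), min δ₂ (min (1 / (12288 * ((2 * (d * L) + L + L : ℕ) : ℝ))) (1 / (BQ + 1))), Cb + 1,
    lt_min (lt_min hα₁ hα₂) (by positivity), lt_min hδ₂ (lt_min (by positivity) (by positivity)), by positivity, ?_⟩
  intro n η hηL c₀ c₁ _ _ hw hρ m _ U V αU hα1 hU1 hreg αV hα1' hV1 hregV hα128 εU hεU hUε hVε δUV hδUV hLUV α δ hα0 hαle hδ0 hδle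
    hRSU hRSV hUb hVb hUη hVη hplU hplV hUV hpp hεg hδg hR2 hposU hposV hQU hQV hKV hKU b
  have hc₁ : 0 < c₁ := Fact.out
  have hαα₁ : α ≤ α₁ := hαle.trans ((min_le_left _ _).trans (min_le_left _ _))
  have hαα₂ : α ≤ α₂ := hαle.trans ((min_le_left _ _).trans (min_le_right _ _))
  have hδδ₂ : δ ≤ δ₂ := hδle.trans (min_le_left _ _)
  have hδN : δ ≤ 1 / (12288 * ((2 * (d * L) + L + L : ℕ) : ℝ)) := hδle.trans ((min_le_right _ _).trans (min_le_left _ _))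
  have hδB : BQ * δ ≤ 1 := by
    have h1 : δ ≤ 1 / (BQ + 1) := hδle.trans ((min_le_right _ _).trans (min_le_right _ _))
    calc BQ * δ ≤ BQ * (1 / (BQ + 1)) := mul_le_mul_of_nonneg_left h1 hBQ
      _ ≤ 1 := by rw [mul_one_div, div_le_one (by positivity)]; linarith
  have hαΞ : Ξ * (α / (1 - r)) ≤ 1 := by
    have h1 : α ≤ (1 - r) / (Ξ + 1) := hαle.trans (min_le_right _ _)
    rw [← mul_div_assoc, div_le_one h1r]
    calc Ξ * α ≤ Ξ * ((1 - r) / (Ξ + 1)) := mul_le_mul_of_nonneg_left h1 hΞ0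
      _ ≤ 1 - r := by
          rw [mul_div_assoc', div_le_iff₀ (add_pos_of_nonneg_of_pos hΞ0 one_pos)]
          calc Ξ * (1 - r) ≤ Ξ * (1 - r) + (1 - r) := le_add_of_nonneg_right h1r.le
            _ = (1 - r) * (Ξ + 1) := by ring
  have hsQδ : 0 ≤ sQ * δ := mul_nonneg hsQ hδ0
  have hΘδ : 0 ≤ Θ * δ := mul_nonneg hΘ.le hδ0
  have hCfin : ((Θ * δ) * Real.sqrt (CKV / γ₁) + (sQ * δ) * CKV) / γ₁ + Real.sqrt (CKU / γ₁) * ((sQ * δ) * Real.sqrt (CKV / γ₁)) = Cb * δ := by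
    rw [hCbdef]; ring
  have hCb1 : Cb * δ * ‖b‖ ≤ (Cb + 1) * δ * ‖b‖ :=
    mul_le_mul_of_nonneg_right (mul_le_mul_of_nonneg_right (le_add_of_nonneg_right zero_le_one) hδ0) (norm_nonneg _)
  have HU := H1 n η hηL c₀ c₁ hw hρ m U αU hα1 hU1 hreg εU hεU hUε hα0 hαα₁ hRSU hUb hUη hplU hεg
  have HV := H1 n η hηL c₀ c₁ hw hρ m V αV hα1' hV1 hregV εU hεU hVε hα0 hαα₁ hRSV hVb hVη hplV hεg
  have HT := H2 n η hηL c₀ c₁ hw hρ m U V αU hα1 hU1 hreg αV hα1' hV1 hregV hα128 εU hεU hUε hVε δUV hδUV hLUV hα0 hαα₂ hδ0 hδδ₂ hRSU hRSV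
    hUb hVb hUη hVη hplU hUV hpp hεg hδg hR2
  obtain ⟨N, hNdef⟩ : ∃ N : BondL2K ℂ d (towerP L m (n + 1)) c₀ W → ℝ, N = fun z =>
      Real.sqrt (‖covCurlL2K ℂ c₀ ((η : ℂ))⁻¹ (adTransportW φ (fun _ : Bond d (towerP L m (n + 1)) => (1 : 𝔸ˣ))) z‖ ^ 2 + ‖covDivL2K ℂ c₀ ((η : ℂ))⁻¹ (adTransportW φ fun _ : Bond d (towerP L m (n + 1)) => (1 : 𝔸ˣ)⁻¹) z‖ ^ 2 + ‖z‖ ^ 2) := ⟨_, rfl⟩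
  have hNz : ∀ z, N z = Real.sqrt (‖covCurlL2K ℂ c₀ ((η : ℂ))⁻¹ (adTransportW φ (fun _ : Bond d (towerP L m (n + 1)) => (1 : 𝔸ˣ))) z‖ ^ 2 + ‖covDivL2K ℂ c₀ ((η : ℂ))⁻¹ (adTransportW φ fun _ : Bond d (towerP L m (n + 1)) => (1 : 𝔸ˣ)⁻¹) z‖ ^ 2 + ‖z‖ ^ 2) := fun z => by rw [hNdef]
  have hN0 : ∀ z, 0 ≤ N z := fun z => by rw [hNz]; exact Real.sqrt_nonneg _
  have hNsq : ∀ z, N z ^ 2 = ‖covCurlL2K ℂ c₀ ((η : ℂ))⁻¹ (adTransportW φ (fun _ : Bond d (towerP L m (n + 1)) => (1 : 𝔸ˣ))) z‖ ^ 2 + ‖covDivL2K ℂ c₀ ((η : ℂ))⁻¹ (adTransportW φ fun _ : Bond d (towerP L m (n + 1)) => (1 : 𝔸ˣ)⁻¹) z‖ ^ 2 + ‖z‖ ^ 2 := fun z => by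
    rw [hNz]; exact Real.sq_sqrt (add_nonneg (add_nonneg (sq_nonneg _) (sq_nonneg _)) (sq_nonneg _))
  have hNn : ∀ z, ‖z‖ ≤ N z := fun z => by
    rw [hNz]; exact le_sqrt_of_sq_le (norm_nonneg _) (le_add_of_nonneg_left (add_nonneg (sq_nonneg _) (sq_nonneg _)))
  have hNc : ∀ z, ‖covCurlL2K ℂ c₀ ((η : ℂ))⁻¹ (adTransportW φ (fun _ : Bond d (towerP L m (n + 1)) => (1 : 𝔸ˣ))) z‖ ≤ N z := fun z => by
    rw [hNz]; exact le_sqrt_of_sq_le (norm_nonneg _) ((le_add_of_nonneg_right (sq_nonneg _)).trans (le_add_of_nonneg_right (sq_nonneg _)))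
  have hNd : ∀ z, ‖covDivL2K ℂ c₀ ((η : ℂ))⁻¹ (adTransportW φ fun _ : Bond d (towerP L m (n + 1)) => (1 : 𝔸ˣ)⁻¹) z‖ ≤ N z := fun z => by
    rw [hNz]; exact le_sqrt_of_sq_le (norm_nonneg _) ((le_add_of_nonneg_left (sq_nonneg _)).trans (le_add_of_nonneg_right (sq_nonneg _)))
  have hNid : ∀ z : BondL2K ℂ d (towerP L m (n + 1)) c₀ W, ‖(LinearMap.id : BondL2K ℂ d (towerP L m (n + 1)) c₀ W →ₗ[ℂ] BondL2K ℂ d (towerP L m (n + 1)) c₀ W) z‖ ≤ N z :=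
    fun z => by rw [LinearMap.id_apply]; exact hNn z
  have hcoerU : ∀ z, γ₁ * N z ^ 2 ≤ RCLike.re ⟪z, laplaceAk L m n φ η U hL αU hα1 hU1 hreg τ (c₀ := c₀) (c₁ := c₁) a z⟫_ℂ := fun z => by
    rw [hNsq]; exact (HU z).1
  have hcoerV : ∀ z, γ₁ * N z ^ 2 ≤ RCLike.re ⟪z, laplaceAk L m n φ η V hL αV hα1' hV1 hregV τ (c₀ := c₀) (c₁ := c₁) a z⟫_ℂ := fun z => by
    rw [hNsq]; exact (HV z).1
  have hT : ∀ u v : BondL2K ℂ d (towerP L m (n + 1)) c₀ W, ‖⟪u, laplaceAk L m n φ η U hL αU hα1 hU1 hreg τ (c₀ := c₀) (c₁ := c₁) a v⟫_ℂ -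
      ⟪u, laplaceAk L m n φ η V hL αV hα1' hV1 hregV τ (c₀ := c₀) (c₁ := c₁) a v⟫_ℂ‖ ≤ Θ * δ * N u * N v :=
    fun u v => by rw [hNz u, hNz v]; exact HT u v
  have hδmax : ∀ j, δUV j ≤ 1 / (12288 * ((2 * (d * L) + L + L : ℕ) : ℝ)) := fun j =>
    (hδg j).trans ((mul_le_of_le_one_right hδ0 (pow_le_one₀ hr0 hr1.le)).trans hδN)
  have hwin : Real.sqrt ((L : ℝ) ^ d) * (Real.sqrt (2 * d) * (75497472 * ((d : ℝ) + 1) * ((2 * (d * L) + L + L : ℕ) : ℝ))) / (1 - r) * δ ≤ 1 := by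
    rw [← hBQdef]; exact hδB
  have hQd : ∀ w : BondL2K ℂ d (towerP L m (n + 1)) c₀ W, ‖(QkW L m n φ U hL αU hα1 hU1 hreg (c₀ := c₀) (c₁ := c₁)) w -
      (QkW L m n φ V hL αV hα1' hV1 hregV (c₀ := c₀) (c₁ := c₁)) w‖ ≤ (sQ * δ) * ‖w‖ := fun w => by
    have h := norm_QkW_sub_QkW_le_L2_linear L m n hL φ hMφ hMφ' hφ hφ' (c₀ := c₀) (c₁ := c₁) U V αU hα1 hU1 hreg αV hα1' hV1 hregV hα128 εU hεU hUε hVε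
      δUV hδUV hδmax hLUV hr0 hr1 hα0 hδ0 hεg (fun j _ => hδg j) hwin w
    rw [sqrt_ratio_diagonal hc₁ hw, mul_one, ← hBQdef] at h
    have hexp : Real.exp (Real.sqrt ((L : ℝ) ^ d) * (Real.sqrt (2 * d) * (102 * (d + 1) ^ 2 * L)) * (α / (1 - r))) ≤ Real.exp 1 := by
      rw [← hΞdef]; exact Real.exp_le_exp.2 hαΞ
    have h2 : Mφ' * Mφ * (2 * Real.exp (Real.sqrt ((L : ℝ) ^ d) * (Real.sqrt (2 * d) * (102 * (d + 1) ^ 2 * L)) * (α / (1 - r))) * (BQ * δ)) ≤ sQ * δ := by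
      rw [hsQdef]
      have := mul_le_mul_of_nonneg_right hexp (mul_nonneg hBQ hδ0)
      calc Mφ' * Mφ * (2 * Real.exp (Real.sqrt ((L : ℝ) ^ d) * (Real.sqrt (2 * d) * (102 * (d + 1) ^ 2 * L)) * (α / (1 - r))) * (BQ * δ))
          = (Mφ' * Mφ * 2) * (Real.exp (Real.sqrt ((L : ℝ) ^ d) * (Real.sqrt (2 * d) * (102 * (d + 1) ^ 2 * L)) * (α / (1 - r))) * (BQ * δ)) := by ring
        _ ≤ (Mφ' * Mφ * 2) * (Real.exp 1 * (BQ * δ)) := mul_le_mul_of_nonneg_left this (by positivity)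
        _ = Mφ' * Mφ * (2 * Real.exp 1 * BQ) * δ := by ring
    exact h.trans (mul_le_mul_of_nonneg_right h2 (norm_nonneg _))
  have hadjU : ∀ (x : BondL2K ℂ d (towerP L m (n + 1)) c₀ W) (z : BondL2K ℂ d m c₁ W), ⟪(QkW L m n φ U hL αU hα1 hU1 hreg (c₀ := c₀) (c₁ := c₁)) x, z⟫_ℂ =
      ⟪x, LinearMap.adjoint (QkW L m n φ U hL αU hα1 hU1 hreg (c₀ := c₀) (c₁ := c₁)) z⟫_ℂ := fun x z => (LinearMap.adjoint_inner_right _ x z).symm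
  have hadjV : ∀ (x : BondL2K ℂ d (towerP L m (n + 1)) c₀ W) (z : BondL2K ℂ d m c₁ W), ⟪(QkW L m n φ V hL αV hα1' hV1 hregV (c₀ := c₀) (c₁ := c₁)) x, z⟫_ℂ =
      ⟪x, LinearMap.adjoint (QkW L m n φ V hL αV hα1' hV1 hregV (c₀ := c₀) (c₁ := c₁)) z⟫_ℂ := fun x z => (LinearMap.adjoint_inner_right _ x z).symm
  have hinjU := adjoint_injective_of_surjective _ hQU
  have hinjV := adjoint_injective_of_surjective _ hQV
  refine ⟨?_, ?_, ?_⟩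
  · refine le_trans ?_ hCb1
    rw [← hCfin]
    have h := norm_apply_H1K_sub_le (𝕜 := ℂ) hposV hadjV hinjV hposU hadjU hinjU N hN0 hNn hγ₁ hγ₁ hΘδ hsQδ hCKV hCKU hcoerU hcoerV hT hQd hKV hKU
      (LinearMap.id : BondL2K ℂ d (towerP L m (n + 1)) c₀ W →ₗ[ℂ] BondL2K ℂ d (towerP L m (n + 1)) c₀ W) hNid b
    rw [LinearMap.id_apply] at h
    exact h
  · refine le_trans ?_ hCb1
    rw [← hCfin]
    exact norm_apply_H1K_sub_le (𝕜 := ℂ) hposV hadjV hinjV hposU hadjU hinjU N hN0 hNn hγ₁ hγ₁ hΘδ hsQδ hCKV hCKU hcoerU hcoerV hT hQd hKV hKU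
      (covCurlL2K ℂ c₀ ((η : ℂ))⁻¹ (adTransportW φ (fun _ : Bond d (towerP L m (n + 1)) => (1 : 𝔸ˣ)))) hNc b
  · refine le_trans ?_ hCb1
    rw [← hCfin]
    exact norm_apply_H1K_sub_le (𝕜 := ℂ) hposV hadjV hinjV hposU hadjU hinjU N hN0 hNn hγ₁ hγ₁ hΘδ hsQδ hCKV hCKU hcoerU hcoerV hT hQd hKV hKU
      (covDivL2K ℂ c₀ ((η : ℂ))⁻¹ (adTransportW φ fun _ : Bond d (towerP L m (n + 1)) => (1 : 𝔸ˣ)⁻¹)) hNd b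

end Literature.MathematicalPhysics.QuantumFieldTheory.Balaban1983to89.B9Eq3126H1kLipschitzEnergyTwoBackgrounds

end
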